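import Literature.NumberTheory.ConnesConsani2021.WeilPropertyP
import Literature.NumberTheory.LFunctions.WeilSemilocalQuadratic
import Literature.NumberTheory.LFunctions.UniformWeilPositivityRH
import Summits.RiemannHypothesis.RiemannHypothesis.Theorems.ConnesPropertyPCriterion
import Summits.RiemannHypothesis.RiemannHypothesis.Theorems.MotivicDoorSemilocalClosed
import Summits.RiemannHypothesis.RiemannHypothesis.Theorems.MotivicDoorSemilocalThreshold
import Summits.RiemannHypothesis.Statement
import HarnessLib

/-!
# C1 isolation decl: `IsolatedCC` — RH-EQUIVALENT (Weil positivity re-indexed by the largest prime entering)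

**Label (line 1): RH-EQUIVALENT.**  Cell `rh-crit` (HOME `run/shared/lean/pub/rh-crit/`), sub-cell `cc/`
(Connes–Consani Weil-positivity corpus 2021–24), seat `rh-crit-cc-iso`; `cc/README.md` §3, `cc/RESIDUAL.md` R0,
`cc/ASSIGNMENTS.md` §4 (ii), `cc/TAUTOLOGY-TEST.md` (referee countersign T-B).  bears_on: W-C/W-P.

The ONE statement the Connes–Consani corpus reduces RH to and cannot prove is Connes's property `P(n)` for
every `n` (A. Connes, arXiv:2602.04022 (2026) §4.1 p. 17: "a property `P(n)`, involving only the Euler factors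
for primes smaller than `n`, and whose validity for all `n` is equivalent to RH"; = Connes–Consani 2021,
Selecta Math. 27, Intro p. 3, the semi-local programme `{∞, 2, …, p}`, `Support(f) ⊂ (p⁻¹, p)`; = Connes–Consani
2023, Enseign. Math. 69, §2.1.2, positivity of `QW_λ` for all `λ` on the pole-free class).  It is typed in the
tree as `Literature.NumberTheory.ConnesConsani2021.weilPropertyP n` (`WeilPropertyP.lean`), and this file gives
it the cell's name `IsolatedCC := ∀ n, weilPropertyP n` — a thin ALIAS, no statement under a second name — and
records, by CITING tree theorems (nothing is re-proved), that it is ONE statement with four spellings: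

* `isolatedCC_iff_riemannHypothesis : IsolatedCC ↔ _root_.RiemannHypothesis` (Mathlib's statement) and
  `isolatedCC_iff_summit : IsolatedCC ↔ Summit.RiemannHypothesis` — this IS
  `ConnesPropertyP.riemannHypothesis_iff_forall_weilPropertyP` (`Theorems/ConnesPropertyPCriterion.lean`), i.e. the
  pole-free form of Weil's criterion (`riemannHypothesis_iff_poleFree`, Bombieri 2000 Thms. 1–2) + "every test
  function lives in some window" (`forall_weilPropertyP_iff_poleFree`).  CONVERSE STATUS: BOTH directions are
  tree theorems — `riemannHypothesis_of_isolatedCC` (the RH-detecting direction, Bombieri Thm. 2 run inside the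
  dipole-stable pole-free class) and `isolatedCC_of_riemannHypothesis` (the easy half, Bombieri Thm. 1).
* `isolatedCC_iff_forall_weilPositivityOn : IsolatedCC ↔ ∀ a > 0, WeilPositivityOn a` — the signature of the
  ledger item `stmt-RiemannHypothesis-0098` (WeilPos thesis) and of `riemannHypothesis_iff_forall_weilPositivityOn`
  (`UniformWeilPositivityRH.lean`): re-indexing `a ↦ n` (window `a = (log n)/2`).
* `isolatedCC_iff_forall_prime_semilocal` — the SEMI-LOCAL spelling: for every prime `q`, positivity of the
  semi-local form `Q_S`, `S = {p prime : p < q}` (`weilSemilocalQuadratic q.primesBelow`), on the pole-free class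
  of the window `(log q)/2`; below the first prime outside `S` the semi-local form IS Weil's form
  (`weilSemilocalQuadratic_eq_weilQuadratic_of_forall`), so this is re-indexing `S ↦ {p < q}`.
* `isolatedCC_iff_forall_le_weilSemilocalThreshold` — threshold language: `a*(primes ≤ N) ≥ (log (N+1))/2` for
  every `N` (`MotivicDoor.SemilocalThreshold.riemannHypothesis_iff_forall_le_weilSemilocalThreshold`).

What is PROVED of it: `P(n)` for `n ≤ 4` (`ConnesPropertyP.weilPropertyP_of_le_four`: Yoshida's archimedean
window, the `S = {∞,2}` certificate `(log 3)/2`, the two-prime rung `log 2`), so the residual is exactly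
`∀ n ≥ 5, P(n)` (`isolatedCC_iff_forall_five_le`); `P(5)` = positivity on `(log 5)/2 = 0.80471…` is beyond the
tree's certified frontier `a = 4023/5000`.

TAUTOLOGY TEST (LADDER-RH §5.6; `cc/TAUTOLOGY-TEST.md`, referee countersign 2026-08-26): T-B — `IsolatedCC` IS
Weil positivity re-indexed (by the prime count `n` instead of the support `a`); NO structural surplus is claimed.
The two naive "finer" transports of the corpus's mechanism are REFUTED in the tree and are cited here as the
fences any semi-local reading must respect: (1) fixed finite `S`, all supports —
`Literature.NumberTheory.LFunctions.not_exists_weilSemilocalPositivityOn_forall : ¬ ∃ S, ∀ a, WeilSemilocalPositivityOn S a`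
(`WeilSemilocalEventuallyNegative.lean`; recorded below as `not_forall_weilSemilocalPositivityOn_primesBelow`: the
coupling `S = {p < q}`, `a = (log q)/2` is essential); (2) the `S = {∞,2}` Sonin-trace transport of CC 2021 Thm. 1,
every window `a > 1/2` — `Summit.RiemannHypothesis.RiemannHypothesis.SoninPoly.Frame050.not_semilocalSoninIneqOn_two_of_gt_half`
(`Theorems/SoninPolyFrame050Main.lean`, kernel certificate).  The finite-codimension variant
`SemilocalSoninIneqFinCodimOn` is RH-free but not RH-detecting.

WHAT THIS IS NOT: not a conjecture of ours, not a Literature fact, not a proving target, not progress toward RH —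
formalising the criterion's corpus fixes WHICH inequality would prove RH, it does not move RH.  Everything else
in the CC chain (CC 2021 §§2–6/App. A–E, the 2023/24/25 sequels) is RH-FREE literature.  No new mathematics in
this file: one alias and re-indexing bookkeeping over cited tree theorems; standard axioms.
-/

set_option linter.dupNamespace false  -- the mandated namespace repeats `RiemannHypothesis`

noncomputable section

open Set Complex
open Literature.NumberTheory.LFunctions Literature.NumberTheory.ConnesConsani2021

namespace Summit.RiemannHypothesis.RiemannHypothesis.Theorems.CCIsolation

/-- **RH-EQUIVALENT (line 1): the isolated inequality of the Connes–Consani corpus** — Connes's property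
`P(n)` for every `n`: Weil's inequality `Σ_v W_v(g ∗ g*) ≤ 0` (tree: `0 ≤ Re (weilQuadratic g)`) for every smooth
`g` with `tsupport g ⊆ [−(log n)/2, (log n)/2]` and `ĝ(i/2) = ĝ(−i/2) = 0`, "involving only the Euler factors for
primes smaller than `n`".  A thin alias of `∀ n, Literature.NumberTheory.ConnesConsani2021.weilPropertyP n`;
equivalent to RH by `isolatedCC_iff_riemannHypothesis` (both directions tree theorems).  Tautology test T-B: Weil
positivity re-indexed; the naive finer transports are refuted in the tree
(`not_exists_weilSemilocalPositivityOn_forall`, `SoninPoly.Frame050.not_semilocalSoninIneqOn_two_of_gt_half`).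
Not a conjecture of ours, not a proving target; nothing here bears on the truth of RH.
[cite: Connes2026Letter, §4.1 p. 17 (arXiv:2602.04022 chunk p0017 L15–18, L35–40); ConnesConsani2021 Intro p. 3] -/
@[conjecture] def IsolatedCC : Prop :=
  ∀ n : ℕ, weilPropertyP n

/-- Unfolding: `IsolatedCC` is literally `∀ n, P(n)`. [folklore] -/
theorem isolatedCC_iff : IsolatedCC ↔ ∀ n : ℕ, weilPropertyP n := Iff.rfl

/-! ## Spelling 1: RH (the kernel equivalence, CITED — `ConnesPropertyP.riemannHypothesis_iff_forall_weilPropertyP`)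

Name-resolution note for readers of FQ types: inside `namespace Summit.…` the bare identifier `RiemannHypothesis`
denotes the summit def `Summit.RiemannHypothesis` (definitionally Mathlib's `_root_.RiemannHypothesis`,
`Summit.RiemannHypothesis_iff`); the tree theorem `ConnesPropertyP.riemannHypothesis_iff_forall_weilPropertyP` therefore
has type `Summit.RiemannHypothesis ↔ ∀ n, weilPropertyP n`.  Below both spellings are written with `_root_` explicitly. -/

/-- **`IsolatedCC ↔ Summit.RiemannHypothesis`** [RH-EQUIVALENT]: Connes 2026 §4.1 "whose validity for all `n` is
equivalent to RH", PROVED in the tree as `ConnesPropertyP.riemannHypothesis_iff_forall_weilPropertyP` (pole-free Weil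
criterion, Bombieri 2000 Thms. 1–2); cited, not re-proved. [cite: Connes2026Letter, §4.1 p. 17; Bombieri2000Weil Thms. 1–2] -/
theorem isolatedCC_iff_summit : IsolatedCC ↔ _root_.Summit.RiemannHypothesis :=
  ConnesPropertyP.riemannHypothesis_iff_forall_weilPropertyP.symm

/-- **`IsolatedCC ↔ RiemannHypothesis`** (Mathlib's statement) [RH-EQUIVALENT]: the same equivalence through
`Summit.RiemannHypothesis_iff : Summit.RiemannHypothesis ↔ _root_.RiemannHypothesis`. [cite: Connes2026Letter, §4.1 p. 17; Bombieri2000Weil Thms. 1–2] -/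
theorem isolatedCC_iff_riemannHypothesis : IsolatedCC ↔ _root_.RiemannHypothesis :=
  isolatedCC_iff_summit.trans _root_.Summit.RiemannHypothesis_iff

/-- The RH-detecting direction: `(∀ n, P(n)) → RH` (Weil's criterion, hard half, run inside the dipole-stable
pole-free class — `riemannHypothesis_iff_poleFree`). [cite: Bombieri2000Weil, Thm. 2] -/
theorem riemannHypothesis_of_isolatedCC (h : IsolatedCC) : _root_.RiemannHypothesis :=
  isolatedCC_iff_riemannHypothesis.1 h

/-- The same, concluding the summit statement by name. [cite: Bombieri2000Weil, Thm. 2] -/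
theorem summit_of_isolatedCC (h : IsolatedCC) : _root_.Summit.RiemannHypothesis :=
  isolatedCC_iff_summit.1 h

/-- CONVERSE (status: PROVED): `RH → ∀ n, P(n)` — the easy half of Weil's criterion
(`weilPropertyP_of_riemannHypothesis`). [cite: Bombieri2000Weil, Thm. 1 eq. (3.2)] -/
theorem isolatedCC_of_riemannHypothesis (h : _root_.RiemannHypothesis) : IsolatedCC :=
  weilPropertyP_of_riemannHypothesis h

/-- Window-free pole-free spelling: `IsolatedCC` iff `0 ≤ Re W(g ⋆ g̃)` for EVERY smooth compactly supported
`g` with `ĝ(0) = ĝ(1) = 0` (`forall_weilPropertyP_iff_poleFree`). [cite: Connes2026Letter, §4.1 p. 17 L35–40] -/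
theorem isolatedCC_iff_poleFree :
    IsolatedCC ↔ ∀ g : ℝ → ℂ, IsWeilTest g → weilMellin g 0 = 0 → weilMellin g 1 = 0 →
      0 ≤ (weilQuadratic g).re :=
  forall_weilPropertyP_iff_poleFree

/-! ## What is proved of it: the residual is `∀ n ≥ 5, P(n)` -/

/-- A tail suffices: `P(n)` is antitone in `n` (`weilPropertyP.mono`), so `IsolatedCC ↔ ∀ n ≥ m, P(n)` for
any `m`. [cite: Connes2026Letter, §4.1 p. 17 L40 (W_p vanishes on functions with support in (p⁻¹, p))] -/
theorem isolatedCC_iff_forall_le (m : ℕ) : IsolatedCC ↔ ∀ n : ℕ, m ≤ n → weilPropertyP n := by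
  refine ⟨fun h n _ ↦ h n, fun h n ↦ ?_⟩
  rcases le_total m n with hmn | hnm
  · exact h n hmn
  · exact (h m le_rfl).mono hnm

/-- **The residual is exactly `∀ n ≥ 5, P(n)`**: `P(n)` for `n ≤ 4` is a tree theorem
(`ConnesPropertyP.weilPropertyP_of_le_four`: windows `(log 2)/2`, `(log 3)/2`, `log 2`), and `P(5)` (window
`(log 5)/2 = 0.8047…`) is open. [cite: Connes2026Letter, §4.1 p. 17 L42–46 (P(2) is what is proved in print)] -/
theorem isolatedCC_iff_forall_five_le : IsolatedCC ↔ ∀ n : ℕ, 5 ≤ n → weilPropertyP n := by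
  refine ⟨fun h n _ ↦ h n, fun h n ↦ ?_⟩
  rcases lt_or_ge n 5 with hn | hn
  · exact ConnesPropertyP.weilPropertyP_of_le_four (by omega)
  · exact h n hn

/-! ## Spelling 2: Weil positivity on every window (ledger item `stmt-RiemannHypothesis-0098`) -/

/-- **`IsolatedCC ↔ ∀ a > 0, WeilPositivityOn a`** (the WeilPos thesis; Yoshida's criterion
`riemannHypothesis_iff_forall_weilPositivityOn`): re-indexing `a ↦ n`.  The forward direction passes through RH
(the window statement has no vanishing conditions). [cite: Bombieri2000Weil, Thm. 2 and §4] -/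
theorem isolatedCC_iff_forall_weilPositivityOn : IsolatedCC ↔ ∀ a : ℝ, 0 < a → WeilPositivityOn a :=
  isolatedCC_iff_riemannHypothesis.trans riemannHypothesis_iff_forall_weilPositivityOn

/-- The same with the named wall `UniformWeilPositivity` of `WeilCriterion.lean`. [cite: Bombieri2000Weil, §4] -/
theorem isolatedCC_iff_uniformWeilPositivity : IsolatedCC ↔ UniformWeilPositivity :=
  isolatedCC_iff_riemannHypothesis.trans uniformWeilPositivity_iff_riemannHypothesis.symm

/-- RH-FREE direction of the re-indexing: positivity on the integer-indexed windows `(log n)/2` (no vanishing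
conditions) gives `IsolatedCC` directly (`weilPropertyP_of_weilPositivityOn`). [cite: Connes2026Letter, §4.1 p. 17 L35–40] -/
theorem isolatedCC_of_forall_weilPositivityOn_log (h : ∀ n : ℕ, WeilPositivityOn (Real.log n / 2)) :
    IsolatedCC :=
  fun n ↦ weilPropertyP_of_weilPositivityOn (h n)

/-- `IsolatedCC ↔ ∀ N, WeilPositivityOn ((log (N+1))/2)` — the finite-prime windows of the tree's rung ladder
(`MotivicDoor.Rungs.riemannHypothesis_iff_forall_finitePrimeWindow`). [cite: Yoshida1992HermitianForms, Prop. 6; Bombieri2000Weil §4] -/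
theorem isolatedCC_iff_forall_finitePrimeWindow :
    IsolatedCC ↔ ∀ N : ℕ, WeilPositivityOn (Real.log ((N : ℝ) + 1) / 2) :=
  isolatedCC_iff_summit.trans MotivicDoor.Rungs.riemannHypothesis_iff_forall_finitePrimeWindow

/-! ## Spelling 3: the semi-local form below the next prime (`S = {p prime : p < q}`) -/

/-- `log ((q − 1) + 1) = log q` on `ℕ` (also at `q = 0`, where both sides are `0`). [folklore] -/
theorem log_pred_add_one (q : ℕ) : Real.log (((q - 1 : ℕ) : ℝ) + 1) = Real.log q := by
  rcases Nat.eq_zero_or_pos q with rfl | hq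
  · simp
  · rw [Nat.cast_pred hq, sub_add_cancel]

/-- Every prime power `n ≤ q − 1` is `{p < q}`-smooth. [folklore] -/
theorem primeFactors_subset_primesBelow_of_le_pred {q n : ℕ} (hn : n ≤ q - 1) :
    n.primeFactors ⊆ q.primesBelow := fun p hp ↦ by
  have hpn := Nat.le_of_mem_primeFactors hp
  have hn0 := (Nat.mem_primeFactors.1 hp).2.2
  exact Nat.mem_primesBelow.2 ⟨by omega, Nat.prime_of_mem_primeFactors hp⟩

/-- **Below the next prime the semi-local form IS Weil's form**: on the window `(log q)/2` only the primes
`p < q` are visible, so `Q_{{p < q}}(g) = Q(g)` (`weilSemilocalQuadratic_eq_weilQuadratic_of_forall` with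
`N = q − 1`). [cite: ConnesConsani2023, §2.1.2 (only the primes p < λ² enter QW_λ); Connes2026Letter §4.1 p. 17 L40] -/
theorem weilSemilocalQuadratic_primesBelow_eq_weilQuadratic (q : ℕ) {g : ℝ → ℂ} (hg : IsWeilTest g)
    (hsupp : tsupport g ⊆ Icc (-(Real.log q / 2)) (Real.log q / 2)) :
    weilSemilocalQuadratic q.primesBelow g = weilQuadratic g := by
  have h := fun hs ↦ weilSemilocalQuadratic_eq_weilQuadratic_of_forall hg (S := q.primesBelow) (N := q - 1)
    (fun n hn _ ↦ primeFactors_subset_primesBelow_of_le_pred hn) hs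
  rw [log_pred_add_one] at h
  exact h hsupp

/-- Semi-local `P(q)` is `P(q)`: positivity of `Q_{{p < q}}` on the pole-free class of the window `(log q)/2`
iff `weilPropertyP q`. [cite: Connes2026Letter, §4.1 p. 17 L15–18 (P(n) involves only the Euler factors of the primes < n)] -/
theorem semilocal_iff_weilPropertyP (q : ℕ) :
    (∀ g : ℝ → ℂ, IsWeilTest g → tsupport g ⊆ Icc (-(Real.log q / 2)) (Real.log q / 2) →
        mulFourier g (I / 2) = 0 → mulFourier g (-(I / 2)) = 0 →
        0 ≤ (weilSemilocalQuadratic q.primesBelow g).re) ↔ weilPropertyP q := by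
  unfold weilPropertyP
  refine forall₂_congr fun g hg ↦ forall_congr' fun hsupp ↦ ?_
  rw [weilSemilocalQuadratic_primesBelow_eq_weilQuadratic q hg hsupp]

/-- `IsolatedCC` in semi-local language, all `q`: for every `q`, the semi-local Weil form at the places
`{∞} ∪ {p < q}` is non-negative on the pole-free class of the window `(log q)/2`. [cite: ConnesConsani2021, Intro p. 3 (semi-local programme {∞,2,…,p}); ConnesConsani2023 §2.1.2] -/
theorem isolatedCC_iff_forall_semilocal :
    IsolatedCC ↔ ∀ q : ℕ, ∀ g : ℝ → ℂ, IsWeilTest g →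
      tsupport g ⊆ Icc (-(Real.log q / 2)) (Real.log q / 2) →
        mulFourier g (I / 2) = 0 → mulFourier g (-(I / 2)) = 0 →
        0 ≤ (weilSemilocalQuadratic q.primesBelow g).re :=
  forall_congr' fun q ↦ (semilocal_iff_weilPropertyP q).symm

/-- **`IsolatedCC` in semi-local language, prime windows**: for every prime `q`, the semi-local Weil form at
`{∞} ∪ {p < q}` is non-negative on the pole-free class of the window `(log q)/2` (re-indexing `S ↦ {p < q}`;
the prime windows suffice since `P(n)` is antitone and primes are unbounded). [cite: ConnesConsani2021, Intro p. 3 (Support(f) ⊂ (p⁻¹, p), places {∞,2,…,p}); Connes2026Letter §4.1 p. 17] -/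
theorem isolatedCC_iff_forall_prime_semilocal :
    IsolatedCC ↔ ∀ q : ℕ, q.Prime → ∀ g : ℝ → ℂ, IsWeilTest g →
      tsupport g ⊆ Icc (-(Real.log q / 2)) (Real.log q / 2) →
        mulFourier g (I / 2) = 0 → mulFourier g (-(I / 2)) = 0 →
        0 ≤ (weilSemilocalQuadratic q.primesBelow g).re := by
  refine ⟨fun h q _ ↦ (semilocal_iff_weilPropertyP q).2 (h q), fun h n ↦ ?_⟩
  obtain ⟨q, hnq, hq⟩ := Nat.exists_infinite_primes n
  exact ((semilocal_iff_weilPropertyP q).1 (h q hq)).mono hnq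

/-- Semi-local positivity WITHOUT vanishing conditions on the coupled window is full Weil positivity there:
`WeilSemilocalPositivityOn {p < q} ((log q)/2) ↔ WeilPositivityOn ((log q)/2)`. [cite: ConnesConsani2023, §2.1.2] -/
theorem weilSemilocalPositivityOn_primesBelow_iff (q : ℕ) :
    WeilSemilocalPositivityOn q.primesBelow (Real.log q / 2) ↔ WeilPositivityOn (Real.log q / 2) := by
  unfold WeilSemilocalPositivityOn WeilPositivityOn
  refine forall₃_congr fun g hg hsupp ↦ ?_
  rw [weilSemilocalQuadratic_primesBelow_eq_weilQuadratic q hg hsupp]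

/-- **`IsolatedCC ↔` coupled semi-local positivity at the prime windows** (no vanishing conditions):
`∀ q prime, WeilSemilocalPositivityOn {p < q} ((log q)/2)`.  The COUPLING `S = {p < q}`, `a = (log q)/2` is
essential — for a FIXED `S` positivity fails for all large `a` (`not_forall_weilSemilocalPositivityOn_primesBelow`).
[cite: ConnesConsani2021, Intro p. 3; ConnesConsani2023 §2.1.2; Bombieri2000Weil Thm. 2] -/
theorem isolatedCC_iff_forall_prime_weilSemilocalPositivityOn :
    IsolatedCC ↔ ∀ q : ℕ, q.Prime → WeilSemilocalPositivityOn q.primesBelow (Real.log q / 2) := by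
  refine ⟨fun h q hq ↦ ?_, fun h n ↦ ?_⟩
  · have hpos : 0 < Real.log q / 2 := by
      have := Real.log_pos (show (1 : ℝ) < q by exact_mod_cast hq.one_lt)
      positivity
    exact (weilSemilocalPositivityOn_primesBelow_iff q).2 (isolatedCC_iff_forall_weilPositivityOn.1 h _ hpos)
  · obtain ⟨q, hnq, hq⟩ := Nat.exists_infinite_primes n
    exact (weilPropertyP_of_weilPositivityOn ((weilSemilocalPositivityOn_primesBelow_iff q).1 (h q hq))).mono hnq

/-- FENCE (cited refutation): for the FIXED set `S = {p < q}` semi-local positivity does NOT hold on all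
windows — `not_exists_weilSemilocalPositivityOn_forall` (odd two-bump witness).  Only the coupled family above is
RH. [cite: Yoshida1992HermitianForms, §2 eq. (2.1) (finite-prime weight); tree refutation WeilSemilocalEventuallyNegative] -/
theorem not_forall_weilSemilocalPositivityOn_primesBelow (q : ℕ) :
    ¬ ∀ a : ℝ, WeilSemilocalPositivityOn q.primesBelow a :=
  fun h ↦ not_exists_weilSemilocalPositivityOn_forall ⟨q.primesBelow, h⟩

/-! ## Spelling 4: threshold language `a*(S)` -/

/-- **`IsolatedCC ↔ ∀ N, (log (N+1))/2 ≤ a*({p ≤ N})`**: the semi-local threshold of the primes `≤ N` reaches its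
coincidence window, for every `N` (`MotivicDoor.SemilocalThreshold.riemannHypothesis_iff_forall_le_weilSemilocalThreshold`).
[cite: Yoshida1992HermitianForms, Prop. 6 (p. 320); Bombieri2000Weil §4] -/
theorem isolatedCC_iff_forall_le_weilSemilocalThreshold :
    IsolatedCC ↔ ∀ N : ℕ, Real.log ((N : ℝ) + 1) / 2 ≤
      MotivicDoor.SemilocalThreshold.weilSemilocalThreshold (Nat.primesBelow (N + 1)) :=
  isolatedCC_iff_summit.trans MotivicDoor.SemilocalThreshold.riemannHypothesis_iff_forall_le_weilSemilocalThreshold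

end Summit.RiemannHypothesis.RiemannHypothesis.Theorems.CCIsolation

end
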